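import Summits.HubbardSuperconductivity.HubbardSuperconductivity.Theorems.AnisotropyChordTransferFibre3FinX3Eval
import Summits.HubbardSuperconductivity.HubbardSuperconductivity.Theorems.AnisotropyChordTransferFibre3FinXC2Cover
import Summits.HubbardSuperconductivity.HubbardSuperconductivity.Theorems.AnisotropyChordTransferFibre3C0Layer

/-!
# Route `AnisotropyChord` / H0 rotor rung: FIN per-`L` GM₃ (X4 split form, `L ≥ 25`) — the row-`N₁` cell with exports and the row-C cell
from certified tables are sound

Soundness of the split form of `…FinX3Eval` (one kernel `decide` cannot hold the two-propagator objects AND the `O(L³)` profile tables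
for `L ≥ 25`, so rows `N₁` and C are separate facts):
* ★ `xbn_cell_sound` / `xbn_cellAny_sound`: a passing `xbnCellOK2` (XB2 row-`N₁` certificate + the literal brackets `nt ⊇ Q/P`,
  `tb ⊇ (tPlusLo, tPlusHi)`) gives `c·U ≤ N₁`, `T⁺ − 3λ₂ ∈ nt` and `tb.1 ≤ T⁺·D ≤ tb.2` for every ground profile of the cell
  (g6's `xb2_cell_sound`, `mem_objP/Q`, `tPlusLo_le2`/`le_tPlusHi2`);
* ★ `xc_cell_soundT` / `xc_cellAny_sound`: a passing `xcCellOKT` on the recomputed tables (kernel facts rewrite them to certified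
  literals) together with `tb.1 ≤ T⁺·D ≤ tb.2` gives the row-C bracket tuple of `KT2Assembly.offPoleTailAbs_of_brackets` with
  `b = bn/bd` (g5's `xcObj_sound` transferred by the program identity `xcObjT_eq`; the inequality bookkeeping is g6's).
Prover seat `hubbard-h0-rotor-p3` g8; helper for piece A = stmt-HubbardSuperconductivity-23918 of rung 19089 (`--supports`, helper
class).  WHAT THIS IS NOT: nothing here proves superconductivity in the Hubbard model (rotor TARGET as worded stays FALSE, g15 verdict);
two hypotheses (rows `N₁`, C per `L` per cell) of ONE conditional reduction.  Tree imports only; no sorry, no new axioms.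
-/

set_option linter.dupNamespace false
set_option autoImplicit false

namespace Summit.HubbardSuperconductivity.HubbardSuperconductivity.Theorems.AnisotropyChord.Transfer.Fibre3

namespace FinXB

open scoped BigOperators
open Finset Hole2 FinCell

variable {L : ℕ} [NeZero L]

/-! ## Row `N₁` with exports -/

/-- ★ THE ROW-`N₁` X4 CELL CERTIFICATE IS SOUND: `c·U ≤ N₁`, `T⁺ − 3λ₂ ∈ nt` and `tb.1 ≤ T⁺·D ≤ tb.2` for every ground profile of
the cell. [folklore] -/
theorem xbn_cell_sound (hL : 5 ≤ L) {Δ lam2 : ℝ} (hΔ0 : 0 < Δ) (hΔ1 : Δ < 1) {f : Tor L → ℝ}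
    (hf : IsGroundTwoMagnon L Δ lam2 f) {la lb : ℤ}
    (hla : (la : ℝ) ≤ lam2 * ((D : ℤ) : ℝ)) (hlb : lam2 * ((D : ℤ) : ℝ) ≤ (lb : ℝ))
    {c : ℚ} {nt : Iv} {tb : ℤ × ℤ} (hcert : xbnCellOK2 L la lb c nt tb (tWedgePt L la) (tWedgePt L lb) = true) :
    (c : ℝ) * Uunit L Δ f ≤ trialGapN1 L Δ f ∧ mem (Tplus L Δ f - 3 * lam2) nt ∧
      ((tb.1 : ℝ) ≤ Tplus L Δ f * ((D : ℤ) : ℝ) ∧ Tplus L Δ f * ((D : ℤ) : ℝ) ≤ (tb.2 : ℝ)) := by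
  unfold xbnCellOK2 at hcert
  simp only [Bool.and_eq_true, decide_eq_true_eq] at hcert
  obtain ⟨⟨hc, hn1, hn2⟩, ht1, ht2⟩ := hcert
  refine ⟨xb2_cell_sound hL hΔ0.le hΔ1 hf hla hlb hc, ?_, ?_⟩
  · have hc' := hc
    unfold xbCellOK2 at hc'
    simp only [Bool.and_eq_true, decide_eq_true_eq] at hc'
    obtain ⟨⟨⟨⟨⟨hchk, hsc⟩, hna⟩, hP⟩, -⟩, -⟩ := hc'
    have H : CellHyp2 (L := L) Δ lam2 f la lb := ⟨⟨hL, hΔ0.le, hΔ1, hf, hla, hlb, hchk, hsc⟩, hna⟩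
    have mP := H.mem_objP
    have mQ := H.mem_objQ
    have hid := sum_piR_C0fn L hf.1
    have e : Tplus L Δ f - 3 * lam2 = (∑ cc : Cfg L, piR L f cc * C0fn L Δ lam2 f cc) * (1 / PiNormSq L f) := by
      have hPpos : 0 < PiNormSq L f := by
        have h1 : (0 : ℝ) < ((xbEval2 L la lb (tWedgePt L la) (tWedgePt L lb)).2.P.1 : ℝ) := by exact_mod_cast hP
        nlinarith [mP.1, D_pos]
      rw [hid]; field_simp
    have m : mem (Tplus L Δ f - 3 * lam2) (ntOf2 L la lb (tWedgePt L la) (tWedgePt L lb)) := by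
      unfold ntOf2
      rw [e]
      exact mem_imul mQ (mem_iinv mP hP)
    obtain ⟨m1, m2⟩ := m
    have h1 : ((nt.1 : ℤ) : ℝ) ≤ (((ntOf2 L la lb (tWedgePt L la) (tWedgePt L lb)).1 : ℤ) : ℝ) := by exact_mod_cast hn1
    have h2 : (((ntOf2 L la lb (tWedgePt L la) (tWedgePt L lb)).2 : ℤ) : ℝ) ≤ ((nt.2 : ℤ) : ℝ) := by exact_mod_cast hn2
    exact ⟨h1.trans m1, m2.trans h2⟩
  · have hc' := hc
    unfold xbCellOK2 at hc'
    simp only [Bool.and_eq_true, decide_eq_true_eq] at hc'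
    obtain ⟨⟨⟨⟨⟨hchk, hsc⟩, hna⟩, hP⟩, -⟩, -⟩ := hc'
    have H : CellHyp2 (L := L) Δ lam2 f la lb := ⟨⟨hL, hΔ0.le, hΔ1, hf, hla, hlb, hchk, hsc⟩, hna⟩
    have hTlo := tPlusLo_le2 H hP
    have hThi := le_tPlusHi2 H hP
    have h1 : ((tb.1 : ℤ) : ℝ) ≤ (((tbOf2 L la lb (tWedgePt L la) (tWedgePt L lb)).1 : ℤ) : ℝ) := by exact_mod_cast ht1
    have h2 : (((tbOf2 L la lb (tWedgePt L la) (tWedgePt L lb)).2 : ℤ) : ℝ) ≤ ((tb.2 : ℤ) : ℝ) := by exact_mod_cast ht2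
    unfold tbOf2 at h1 h2
    exact ⟨h1.trans hTlo, hThi.trans h2⟩

/-- ★ one row-`N₁` X4 cell (cover form). [folklore] -/
theorem xbn_cellAny_sound (L : ℕ) [NeZero L] (hL : 5 ≤ L) {d1 : ℚ} {Δ lam2 : ℝ} (hΔ0 : 0 < Δ)
    (hΔd : Δ ≤ (d1 : ℝ)) (hΔ1 : Δ < 1) {f : Tor L → ℝ} (hf : IsGroundTwoMagnon L Δ lam2 f) {la lb : ℤ}
    (hla : (la : ℝ) ≤ lam2 * ((D : ℤ) : ℝ)) (hlb : lam2 * ((D : ℤ) : ℝ) ≤ (lb : ℝ)) {c : ℚ} {nt : Iv} {tb : ℤ × ℤ}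
    (hok : xbnCellAny2 L d1 la lb c nt tb = true) :
    (c : ℝ) * Uunit L Δ f ≤ trialGapN1 L Δ f ∧ mem (Tplus L Δ f - 3 * lam2) nt ∧
      ((tb.1 : ℝ) ≤ Tplus L Δ f * ((D : ℤ) : ℝ) ∧ Tplus L Δ f * ((D : ℤ) : ℝ) ≤ (tb.2 : ℝ)) := by
  have hL3 : 3 ≤ L := by omega
  have hD := D_pos
  have hlam : 0 < lam2 := lam2_pos L hL3 hΔ1 hf.1
  have hΔe : Δ = deltaOfLam L lam2 := ground_delta_eq L hL hΔ0.le hΔ1 hf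
  unfold xbnCellAny2 xbnCellAnyT2 at hok
  simp only [Bool.or_eq_true, Bool.and_eq_true, decide_eq_true_eq] at hok
  rcases hok with (⟨⟨hpos, hnum⟩, hG0⟩ | ⟨hgc, hvac⟩) | hcert
  · exact (vacuous_of_num_neg (L := L) hL3 hlam hla hlb hpos hnum hG0 hΔ0 hΔ1 hΔe).elim
  · exfalso
    have hmd := mem_delta_cell L hL3 hlam hla hlb hgc
    rw [← hΔe] at hmd
    obtain ⟨hlo, hhi⟩ := hmd
    rcases hvac with hneg | hbig
    · have : ((((deltaIv L la lb).2 : ℤ)) : ℝ) < 0 := by exact_mod_cast hneg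
      nlinarith
    · have hbig' : (d1 : ℝ) * ((D : ℤ) : ℝ) < ((((deltaIv L la lb).1 : ℤ)) : ℝ) := by
        have e : (((D : ℚ)) : ℝ) = ((D : ℤ) : ℝ) := by norm_cast
        rw [← e]; exact_mod_cast hbig
      nlinarith
  · exact xbn_cell_sound hL hΔ0 hΔ1 hf hla hlb hcert

/-! ## Row C from the tables -/

/-- the row-C objects from the recomputed tables: `M, Chi, Nhi, η` are g5's, `Tlo, Thi` are the given brackets. [folklore] -/
theorem xcObjT_fields (L : ℕ) (la lb : ℤ) (S : XBScal) (O : XBObj) (tb : ℤ × ℤ) :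
    (xcObjT L S tb (fTab4 L la lb) (gTab4 L la lb)).M = (xcObj L la lb S O).M ∧
    (xcObjT L S tb (fTab4 L la lb) (gTab4 L la lb)).chi = (xcObj L la lb S O).chi ∧
    (xcObjT L S tb (fTab4 L la lb) (gTab4 L la lb)).nhi = (xcObj L la lb S O).nhi ∧
    (xcObjT L S tb (fTab4 L la lb) (gTab4 L la lb)).eta = (xcObj L la lb S O).eta ∧
    (xcObjT L S tb (fTab4 L la lb) (gTab4 L la lb)).tlo = tb.1 ∧
    (xcObjT L S tb (fTab4 L la lb) (gTab4 L la lb)).thi = tb.2 := by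
  unfold xcObjT xcObj
  exact ⟨rfl, rfl, rfl, rfl, rfl, rfl⟩

/-- ★ THE ROW-C X4 CELL CERTIFICATE IS SOUND: with `tb.1 ≤ T⁺·D ≤ tb.2`, a passing `xcCellOKT` on the recomputed tables gives the
row-C bracket tuple of `KT2Assembly.offPoleTailAbs_of_brackets` (`b = bn/bd`) for every ground profile of the cell. [folklore] -/
theorem xc_cell_soundT (hL : 5 ≤ L) {Δ lam2 : ℝ} (hΔ0 : 0 < Δ) (hΔ1 : Δ < 1) {f : Tor L → ℝ}
    (hf : IsGroundTwoMagnon L Δ lam2 f) {la lb : ℤ}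
    (hla : (la : ℝ) ≤ lam2 * ((D : ℤ) : ℝ)) (hlb : lam2 * ((D : ℤ) : ℝ) ≤ (lb : ℝ))
    {tb : ℤ × ℤ} (hTlo : (tb.1 : ℝ) ≤ Tplus L Δ f * ((D : ℤ) : ℝ)) (hThi : Tplus L Δ f * ((D : ℤ) : ℝ) ≤ (tb.2 : ℝ))
    {bn bd : ℕ} (hcert : xcCellOKT L la lb bn bd tb (fTab4 L la lb) (gTab4 L la lb) = true) :
    ∃ Chi Nhi Plo Llo Tlo Thi : ℝ,
      cs2 L f ≤ Chi ∧ nC0p L Δ f ≤ Nhi ∧ Plo ≤ polePart L Δ f ∧ Llo ≤ lowNormPart L Δ f ∧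
      Tlo ≤ Tplus L Δ f ∧ Tplus L Δ f ≤ Thi ∧ Thi ≤ 2 * eps1 L ∧ 0 ≤ Tlo ∧
      (3 * Real.sqrt Chi + 3 * Real.sqrt Nhi) ^ 2 - Plo - Llo
        ≤ ((bn : ℝ) / bd) * ((L : ℝ) ^ 2 * lam2 / 4) * (2 * eps1 L - Thi) * (3 * ((L : ℝ) ^ 2) ^ 2 * Tlo) := by
  unfold xcCellOKT at hcert
  simp only [Bool.and_eq_true, decide_eq_true_eq] at hcert
  obtain ⟨⟨⟨⟨⟨⟨⟨hchk, hsc⟩, hbd⟩, hMok⟩, htlo0⟩, hthi⟩, heta0⟩, hineq⟩ := hcert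
  have H : CellHyp (L := L) Δ lam2 f la lb := ⟨hL, hΔ0.le, hΔ1, hf, hla, hlb, hchk, hsc⟩
  have hD := D_pos
  set S := xbScal L la lb (gresCellTab L (cosTab L) la lb) with hSdef
  set C := xcObjT L S tb (fTab4 L la lb) (gTab4 L la lb) with hCdef
  have eS : (xbEval L la lb).1 = S := rfl
  have hfld := xcObjT_fields L la lb S (xbEval L la lb).2 tb
  have hMok' : xcMok L (fTab4 L la lb) (xcObj L la lb (xbEval L la lb).1 (xbEval L la lb).2).M = true := by
    rw [eS, ← hfld.1]; exact hMok
  obtain ⟨Chi, Nhi, hChi, hNhi, hChi0, hNhi0, mChi, mNhi, mEta⟩ := xcObj_sound H hMok'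
  rw [eS] at mChi mNhi mEta
  rw [← hfld.2.1] at mChi
  rw [← hfld.2.2.1] at mNhi
  rw [← hfld.2.2.2.1] at mEta
  have etlo : C.tlo = tb.1 := hfld.2.2.2.2.1
  have ethi : C.thi = tb.2 := hfld.2.2.2.2.2
  have meps : mem (eps1 L) S.eps1 := H.hS.2.2.2.2.2.2.2.2.2.2
  refine ⟨Chi, Nhi, 0, 0, (C.tlo : ℝ) / ((D : ℤ) : ℝ), (C.thi : ℝ) / ((D : ℤ) : ℝ), hChi, hNhi,
    polePartNonneg_holds L Δ f, lowNormPartNonneg_holds L Δ f, ?_, ?_, ?_, ?_, ?_⟩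
  · rw [div_le_iff₀ hD, etlo]; exact hTlo
  · rw [le_div_iff₀ hD, ethi]; exact hThi
  · have h1 : ((C.thi : ℤ) : ℝ) ≤ 2 * ((S.eps1.1 : ℤ) : ℝ) := by exact_mod_cast hthi
    rw [div_le_iff₀ hD]
    nlinarith [meps.1]
  · have : (0 : ℝ) ≤ ((C.tlo : ℤ) : ℝ) := by exact_mod_cast htlo0
    positivity
  · rw [sub_zero, sub_zero]
    have ms := mem_iadd (mem_iscale 3 (mem_isqrt (Real.sqrt_nonneg Chi) (by rw [Real.sq_sqrt hChi0]; exact mChi)))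
      (mem_iscale 3 (mem_isqrt (Real.sqrt_nonneg Nhi) (by rw [Real.sq_sqrt hNhi0]; exact mNhi)))
    set s := iadd (iscale 3 (isqrt C.chi)) (iscale 3 (isqrt C.nhi)) with hsdef
    obtain ⟨-, hs2⟩ := ms
    push_cast at hs2
    have hv0 : 0 ≤ 3 * Real.sqrt Chi + 3 * Real.sqrt Nhi := by positivity
    have hvle : 3 * Real.sqrt Chi + 3 * Real.sqrt Nhi ≤ (s.2 : ℝ) / ((D : ℤ) : ℝ) := by
      rw [le_div_iff₀ hD]; exact hs2
    have e2 := (mem_imul (mem_ipt s.2) (mem_ipt s.2)).2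
    have hsq : (3 * Real.sqrt Chi + 3 * Real.sqrt Nhi) ^ 2 * ((D : ℤ) : ℝ) ≤ ((sqSum C : ℤ) : ℝ) := by
      have hle : (3 * Real.sqrt Chi + 3 * Real.sqrt Nhi) ^ 2 ≤ ((s.2 : ℝ) / ((D : ℤ) : ℝ)) * ((s.2 : ℝ) / ((D : ℤ) : ℝ)) := by
        rw [sq]; exact mul_le_mul hvle hvle hv0 (hv0.trans hvle)
      unfold sqSum
      exact (mul_le_mul_of_nonneg_right hle hD.le).trans e2
    have mR := mem_idivn (mem_iscale (bn * (3 * (L * L) ^ 2))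
      (mem_imul (mem_imul (mem_ipt C.eta.1) (mem_isub (mem_iscale 2 (mem_ipt S.eps1.1)) (mem_ipt C.thi))) (mem_ipt C.tlo)))
      (show (0 : ℤ) < (bd : ℤ) by exact_mod_cast hbd)
    obtain ⟨hRlo, -⟩ := mR
    have hineqR : ((sqSum C : ℤ) : ℝ) ≤ ((rhsLo L S C bn bd : ℤ) : ℝ) := by exact_mod_cast hineq
    unfold rhsLo at hineqR
    have hEta : ((C.eta.1 : ℤ) : ℝ) / ((D : ℤ) : ℝ) ≤ (L : ℝ) ^ 2 * lam2 / 4 := by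
      rw [div_le_iff₀ hD]; have := mEta.1; unfold etaEff at this; exact this
    have hEta0 : 0 ≤ ((C.eta.1 : ℤ) : ℝ) / ((D : ℤ) : ℝ) := by
      have : (0 : ℝ) ≤ ((C.eta.1 : ℤ) : ℝ) := by exact_mod_cast heta0
      positivity
    have hEps : ((S.eps1.1 : ℤ) : ℝ) / ((D : ℤ) : ℝ) ≤ eps1 L := by rw [div_le_iff₀ hD]; exact meps.1
    have hThi' : ((C.thi : ℤ) : ℝ) / ((D : ℤ) : ℝ) ≤ 2 * (((S.eps1.1 : ℤ) : ℝ) / ((D : ℤ) : ℝ)) := by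
      rw [div_le_iff₀ hD]
      have h1 : ((C.thi : ℤ) : ℝ) ≤ 2 * ((S.eps1.1 : ℤ) : ℝ) := by exact_mod_cast hthi
      have : 2 * (((S.eps1.1 : ℤ) : ℝ) / ((D : ℤ) : ℝ)) * ((D : ℤ) : ℝ) = 2 * ((S.eps1.1 : ℤ) : ℝ) := by
        field_simp
      linarith
    have hTlo0 : 0 ≤ ((C.tlo : ℤ) : ℝ) / ((D : ℤ) : ℝ) := by
      have : (0 : ℝ) ≤ ((C.tlo : ℤ) : ℝ) := by exact_mod_cast htlo0
      positivity
    have hbn : (0 : ℝ) ≤ bn := by positivity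
    have hbd' : (0 : ℝ) < bd := by exact_mod_cast hbd
    have hmono :
        ((bn * (3 * (L * L) ^ 2) : ℕ) : ℝ) *
            ((((C.eta.1 : ℤ) : ℝ) / ((D : ℤ) : ℝ)) * (((2 : ℕ) : ℝ) * (((S.eps1.1 : ℤ) : ℝ) / ((D : ℤ) : ℝ))
              - ((C.thi : ℤ) : ℝ) / ((D : ℤ) : ℝ)) * (((C.tlo : ℤ) : ℝ) / ((D : ℤ) : ℝ))) / ((bd : ℤ) : ℝ)
          ≤ ((bn : ℝ) / bd) * ((L : ℝ) ^ 2 * lam2 / 4) * (2 * eps1 L - ((C.thi : ℤ) : ℝ) / ((D : ℤ) : ℝ))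
              * (3 * ((L : ℝ) ^ 2) ^ 2 * (((C.tlo : ℤ) : ℝ) / ((D : ℤ) : ℝ))) := by
      have hA : (((C.eta.1 : ℤ) : ℝ) / ((D : ℤ) : ℝ)) * (((2 : ℕ) : ℝ) * (((S.eps1.1 : ℤ) : ℝ) / ((D : ℤ) : ℝ))
              - ((C.thi : ℤ) : ℝ) / ((D : ℤ) : ℝ))
          ≤ ((L : ℝ) ^ 2 * lam2 / 4) * (2 * eps1 L - ((C.thi : ℤ) : ℝ) / ((D : ℤ) : ℝ)) := by
        push_cast
        exact mul_le_mul hEta (by linarith) (by linarith) ((hEta0).trans hEta)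
      have hB := mul_le_mul_of_nonneg_right hA hTlo0
      have hC := mul_le_mul_of_nonneg_left hB (show (0 : ℝ) ≤ ((bn * (3 * (L * L) ^ 2) : ℕ) : ℝ) / ((bd : ℤ) : ℝ) by
        push_cast; positivity)
      have e1 : ((bn * (3 * (L * L) ^ 2) : ℕ) : ℝ) *
            ((((C.eta.1 : ℤ) : ℝ) / ((D : ℤ) : ℝ)) * (((2 : ℕ) : ℝ) * (((S.eps1.1 : ℤ) : ℝ) / ((D : ℤ) : ℝ))
              - ((C.thi : ℤ) : ℝ) / ((D : ℤ) : ℝ)) * (((C.tlo : ℤ) : ℝ) / ((D : ℤ) : ℝ))) / ((bd : ℤ) : ℝ)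
          = ((bn * (3 * (L * L) ^ 2) : ℕ) : ℝ) / ((bd : ℤ) : ℝ) *
            ((((C.eta.1 : ℤ) : ℝ) / ((D : ℤ) : ℝ)) * (((2 : ℕ) : ℝ) * (((S.eps1.1 : ℤ) : ℝ) / ((D : ℤ) : ℝ))
              - ((C.thi : ℤ) : ℝ) / ((D : ℤ) : ℝ)) * (((C.tlo : ℤ) : ℝ) / ((D : ℤ) : ℝ))) := by ring
      have e2 : ((bn * (3 * (L * L) ^ 2) : ℕ) : ℝ) / ((bd : ℤ) : ℝ) *
            (((L : ℝ) ^ 2 * lam2 / 4) * (2 * eps1 L - ((C.thi : ℤ) : ℝ) / ((D : ℤ) : ℝ)) * (((C.tlo : ℤ) : ℝ) / ((D : ℤ) : ℝ)))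
          = ((bn : ℝ) / bd) * ((L : ℝ) ^ 2 * lam2 / 4) * (2 * eps1 L - ((C.thi : ℤ) : ℝ) / ((D : ℤ) : ℝ))
              * (3 * ((L : ℝ) ^ 2) ^ 2 * (((C.tlo : ℤ) : ℝ) / ((D : ℤ) : ℝ))) := by push_cast; ring
      rw [e1]; rw [e2] at hC; exact hC
    have key : (3 * Real.sqrt Chi + 3 * Real.sqrt Nhi) ^ 2 * ((D : ℤ) : ℝ)
        ≤ ((bn : ℝ) / bd) * ((L : ℝ) ^ 2 * lam2 / 4) * (2 * eps1 L - ((C.thi : ℤ) : ℝ) / ((D : ℤ) : ℝ))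
              * (3 * ((L : ℝ) ^ 2) ^ 2 * (((C.tlo : ℤ) : ℝ) / ((D : ℤ) : ℝ))) * ((D : ℤ) : ℝ) := by
      refine hsq.trans (hineqR.trans (hRlo.trans ?_))
      exact mul_le_mul_of_nonneg_right hmono hD.le
    exact le_of_mul_le_mul_right key hD

/-- ★ one row-C X4 cell (cover form): vacuous branches contradictory, certified branch gives the bracket tuple. [folklore] -/
theorem xc_cellAny_sound (L : ℕ) [NeZero L] (hL : 5 ≤ L) {d1 : ℚ} {bd : ℕ} {Δ lam2 : ℝ} (hΔ0 : 0 < Δ)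
    (hΔd : Δ ≤ (d1 : ℝ)) (hΔ1 : Δ < 1) {f : Tor L → ℝ} (hf : IsGroundTwoMagnon L Δ lam2 f) {la lb : ℤ}
    (hla : (la : ℝ) ≤ lam2 * ((D : ℤ) : ℝ)) (hlb : lam2 * ((D : ℤ) : ℝ) ≤ (lb : ℝ)) {bn : ℕ} {tb : ℤ × ℤ}
    (hTlo : (tb.1 : ℝ) ≤ Tplus L Δ f * ((D : ℤ) : ℝ)) (hThi : Tplus L Δ f * ((D : ℤ) : ℝ) ≤ (tb.2 : ℝ))
    (hok : xcCellAnyT0 L d1 bd la lb bn tb = true) :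
    ∃ Chi Nhi Plo Llo Tlo Thi : ℝ,
      cs2 L f ≤ Chi ∧ nC0p L Δ f ≤ Nhi ∧ Plo ≤ polePart L Δ f ∧ Llo ≤ lowNormPart L Δ f ∧
      Tlo ≤ Tplus L Δ f ∧ Tplus L Δ f ≤ Thi ∧ Thi ≤ 2 * eps1 L ∧ 0 ≤ Tlo ∧
      (3 * Real.sqrt Chi + 3 * Real.sqrt Nhi) ^ 2 - Plo - Llo
        ≤ ((bn : ℝ) / bd) * ((L : ℝ) ^ 2 * lam2 / 4) * (2 * eps1 L - Thi) * (3 * ((L : ℝ) ^ 2) ^ 2 * Tlo) := by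
  have hL3 : 3 ≤ L := by omega
  have hD := D_pos
  have hlam : 0 < lam2 := lam2_pos L hL3 hΔ1 hf.1
  have hΔe : Δ = deltaOfLam L lam2 := ground_delta_eq L hL hΔ0.le hΔ1 hf
  unfold xcCellAnyT0 xcCellAnyTT at hok
  simp only [Bool.or_eq_true, Bool.and_eq_true, decide_eq_true_eq] at hok
  rcases hok with (⟨⟨hpos, hnum⟩, hG0⟩ | ⟨hgc, hvac⟩) | hcert
  · exact (vacuous_of_num_neg (L := L) hL3 hlam hla hlb hpos hnum hG0 hΔ0 hΔ1 hΔe).elim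
  · exfalso
    have hmd := mem_delta_cell L hL3 hlam hla hlb hgc
    rw [← hΔe] at hmd
    obtain ⟨hlo, hhi⟩ := hmd
    rcases hvac with hneg | hbig
    · have : ((((deltaIv L la lb).2 : ℤ)) : ℝ) < 0 := by exact_mod_cast hneg
      nlinarith
    · have hbig' : (d1 : ℝ) * ((D : ℤ) : ℝ) < ((((deltaIv L la lb).1 : ℤ)) : ℝ) := by
        have e : (((D : ℚ)) : ℝ) = ((D : ℤ) : ℝ) := by norm_cast
        rw [← e]; exact_mod_cast hbig
      nlinarith
  · exact xc_cell_soundT hL hΔ0 hΔ1 hf hla hlb hTlo hThi hcert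

end FinXB

end Summit.HubbardSuperconductivity.HubbardSuperconductivity.Theorems.AnisotropyChord.Transfer.Fibre3
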